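import Mathlib
import HarnessLib
import Summits.Ventures.LatticeQCDFlow.Scaling.AutoregressiveGaugePlaquetteMarginal
import Summits.Ventures.LatticeQCDFlow.Scaling.AutoregressiveGaugeCornerMoves
import Summits.Ventures.LatticeQCDFlow.Scaling.TorusPlaquetteGeometry

/-!
# LatticeQCDFlow / Scaling — EVERY compact gauge group, EVERY dimension: the link closing a
# plaquette reads EACH of its three staple links (`SU(3)`, `d = 4` included)

HONEST FRAMING: exact (Metropolis-corrected) sampling algorithms for lattice gauge theory;
figures of merit are autocorrelation/cost numbers at stated couplings and volumes; no
continuum-physics claim.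

Venture `LatticeQCDFlow` (cell pub-lqcd), topic `Scaling`, FANOUT row 30 (lean-1, GEN-18) — OUR WORK on
THEORY-2.md §4 row C5, gauge case; sequel of `Scaling/AutoregressiveGaugePlaquetteMarginal` (the
engine: the marginal over the links off a plaquette reads the closing link) and
`Scaling/AutoregressiveGaugeCornerMoves` (blindness of an exact conditional propagates across a site
whose other links are integrated).  Compact `G`, continuous `ρ` with a central element acting by a
scalar `ω ≠ 1`, `|ω| = 1` (`SU(N)` fundamental, `U(1)`), every `d`, `L ≥ 2`, `β > 0`; plaquette
`p = (x; k, l)`, `k < l`; links `e₁ = (x,k)` (closing), `e₂ = (x+e_k, l)`, `e₃ = (x+e_l, k)`, `e₄ = (x, l)`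
(the staple); `s` = all other links; `N = A_s e^{−βS_W}`, `M = A_{insert e₁ s} e^{−βS_W}`.

* **`wilson_closingLink_reads_each_stapleLink`** — for EACH staple link `b ∈ {e₂, e₃, e₄}` there are
  two configurations differing ONLY at `b` on which the exact conditional `N/M` of `U_{e₁}` differs.
  Proof: the corner moves at `x + e_k` (through: `e₁ → e₂`), `x + e_k + e_l` (in: `e₂, e₃`), `x + e_l`
  (through: `e₄ → e₃`) — at each corner the two plaquette links are the only retained links — make
  blindness to a staple link propagate to blindness to `e₁`, i.e. of `N` (`M` is blind to `e₁`),
  against the engine; `wilson_u1_closingLink_reads_each_stapleLink` — the `U(1)` instance.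
* **`wilson_stapleLink_influence_eq`** — QUANTITATIVE SYMMETRY, configuration by configuration: for every `U`
  and each staple link `b`, `∫ |R(U[b ↦ v]) − R(U)| dv = ∫ |R(U[e₁ ↦ v]) − R(U)| dv` (`R = N/M`, Haar
  probability): resampling a staple link moves the exact conditional exactly as much, in `L¹(Haar)`, as
  resampling the closing link itself (corner moves + translation/inversion invariance; any `ρ`, `β`).

READING (value-free, C5): for Wilson lattice gauge theory with any such gauge group in any dimension
— `SU(3)` in four dimensions included — at every `β > 0` and volume, the exact autoregressive
conditional of a link given the staple of a plaquette it closes (everything else integrated)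
genuinely depends on each staple link: the gauge-reduced context "one holonomy class" (GEN-15/16) is
attained and not smaller.  NOT CLAIMED: which function of the staple is read; any rate in `β`; any
number of ours.  Elementary over the parents; no `def`; nothing is cited as a fact; no `sorry`.
-/

noncomputable section

namespace Summit.Ventures.LatticeQCDFlow.Theory2.Autoregressive

open MeasureTheory Function Set
open Literature.MathematicalPhysics.QuantumFieldTheory Literature.MathematicalPhysics.QuantumLattice
open Summit.Ventures.LatticeQCDFlow.Exactness
open Summit.Ventures.LatticeQCDFlow.Theory2.Lattice.TorusGeom (single_ne_zero single_inj add_single_ne_self)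

variable {d L N : ℕ} {G : Type*} [Group G] [TopologicalSpace G] [IsTopologicalGroup G]
  [CompactSpace G] [SecondCountableTopology G] [MeasurableSpace G] [BorelSpace G] [NeZero L]
  (ρ : G →* Matrix (Fin N) (Fin N) ℂ)

/-- **THE LINK CLOSING A PLAQUETTE READS EACH OF ITS THREE STAPLE LINKS — EVERY COMPACT GAUGE GROUP,
EVERY DIMENSION** (continuous `ρ` with a central element acting by a scalar `ω ≠ 1`, `|ω| = 1`;
`L ≥ 2`, `β > 0`, plaquette `p = (x; k, l)`).  With `s` the links off `p`, `e₁ = (x, k)`, `N = A_s e^{−βS_W}`,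
`M = A_{insert e₁ s} e^{−βS_W}`: for EACH staple link `b ∈ {(x+e_k, l), (x+e_l, k), (x, l)}` there are
two configurations differing ONLY at `b` on which the exact conditional `N/M` of `U_{e₁}` differs.
[ours] -/
theorem wilson_closingLink_reads_each_stapleLink [NeZero N] (hρ : Continuous ρ) (hL : 2 ≤ L)
    {z : G} {ω : ℂ} (hω : ρ z = ω • (1 : Matrix (Fin N) (Fin N) ℂ)) (hω1 : ‖ω‖ = 1) (hne : ω ≠ 1)
    {β : ℝ} (hβ : 0 < β) (p : Plaquette d L) (b : Edge d L)
    (hb : b ∈ ({(p.1.shift p.2.1.1, p.2.1.2), (p.1.shift p.2.1.2, p.2.1.1), (p.1, p.2.1.2)} : Finset (Edge d L))) :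
    ∃ U U' : GaugeConfig d L G,
      (∀ e : Edge d L, e ≠ b → U e = U' e) ∧
      coordAvg (haarProbability G)
          (Finset.univ \ {(p.1, p.2.1.1), (p.1.shift p.2.1.1, p.2.1.2), (p.1.shift p.2.1.2, p.2.1.1), (p.1, p.2.1.2)})
          (fun V : GaugeConfig d L G => Real.exp (-β * wilsonAction ρ V)) U /
        coordAvg (haarProbability G)
          (insert (p.1, p.2.1.1)
            (Finset.univ \ {(p.1, p.2.1.1), (p.1.shift p.2.1.1, p.2.1.2), (p.1.shift p.2.1.2, p.2.1.1), (p.1, p.2.1.2)}))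
          (fun V : GaugeConfig d L G => Real.exp (-β * wilsonAction ρ V)) U ≠
      coordAvg (haarProbability G)
          (Finset.univ \ {(p.1, p.2.1.1), (p.1.shift p.2.1.1, p.2.1.2), (p.1.shift p.2.1.2, p.2.1.1), (p.1, p.2.1.2)})
          (fun V : GaugeConfig d L G => Real.exp (-β * wilsonAction ρ V)) U' /
        coordAvg (haarProbability G)
          (insert (p.1, p.2.1.1)
            (Finset.univ \ {(p.1, p.2.1.1), (p.1.shift p.2.1.1, p.2.1.2), (p.1.shift p.2.1.2, p.2.1.1), (p.1, p.2.1.2)}))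
          (fun V : GaugeConfig d L G => Real.exp (-β * wilsonAction ρ V)) U' := by
  classical
  set μ := haarProbability G with hμ
  set x := p.1 with hx
  set k := p.2.1.1 with hk
  set l := p.2.1.2 with hl
  have hkl : k ≠ l := ne_of_lt p.2.2
  set e₁ : Edge d L := (x, k) with he₁
  set e₂ : Edge d L := (x.shift k, l) with he₂
  set e₃ : Edge d L := (x.shift l, k) with he₃
  set e₄ : Edge d L := (x, l) with he₄
  set s : Finset (Edge d L) := Finset.univ \ {e₁, e₂, e₃, e₄} with hs
  set F : GaugeConfig d L G → ℝ := fun V => Real.exp (-β * wilsonAction ρ V) with hF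
  set Nf := coordAvg μ s F with hN'
  set M := coordAvg μ (insert e₁ s) F with hM
  -- geometry (`L ≥ 2`, `k ≠ l`)
  have hek : ∀ z : Site d L, z.shift k ≠ z := fun z => add_single_ne_self hL z k
  have hel : ∀ z : Site d L, z.shift l ≠ z := fun z => add_single_ne_self hL z l
  have hkl' : x.shift k ≠ x.shift l := fun h => hkl (single_inj hL (add_left_cancel h))
  have hcomm : (x.shift k).shift l = (x.shift l).shift k := by
    simp only [Site.shift]; exact add_right_comm _ _ _
  have hekl : (x.shift k).shift l ≠ x := by
    intro h
    apply single_add_single_ne_zero_of_ne hL hkl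
    have h' : x + (Pi.single k 1 + Pi.single l 1) = x + 0 := by
      rw [add_zero, ← add_assoc]; exact h
    exact add_left_cancel h'
  have hmem_s : ∀ e : Edge d L, e ∈ s ↔ e ≠ e₁ ∧ e ≠ e₂ ∧ e ≠ e₃ ∧ e ≠ e₄ := by
    intro e; simp [hs]
  have hinc : ∀ (e : Edge d L) (y : Site d L), e.1 ≠ y → e.1.shift e.2 ≠ y →
      ¬ (e.1 = y ∨ e.1.shift e.2 = y) := fun e y h1 h2 h => h.elim h1 h2
  -- weight facts
  obtain ⟨hFm, B, hFlo, hFhi⟩ := wilsonWeight_props (d := d) (L := L) ρ hρ β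
  have hFgi : IsGaugeInvariant F := isGaugeInvariant_wilsonWeightFun ρ β
  have hMb : ∀ U, Real.exp (-(|β| * B)) ≤ M U ∧ M U ≤ Real.exp (|β| * B) := fun U =>
    coordAvg_mem_Icc μ (insert e₁ s) hFm hFlo hFhi U
  have hMpos : ∀ U, 0 < M U := fun U => lt_of_lt_of_le (Real.exp_pos _) (hMb U).1
  have hMe₁ : ∀ (U : GaugeConfig d L G) (v : G), M (update U e₁ v) = M U := by
    intro U v
    refine coordAvg_congr_off (insert e₁ s) F fun e he => ?_
    have : e ≠ e₁ := fun h => he (h ▸ Finset.mem_insert_self e₁ s)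
    exact update_of_ne this _ _
  -- Step 0: `R = N/M` is not blind to `e₁`
  have hR1 : ¬ ∀ (U : GaugeConfig d L G) (v : G),
      Nf (update U e₁ v) / M (update U e₁ v) = Nf U / M U := by
    intro hbl
    obtain ⟨U, v, hUv⟩ := wilson_plaquetteMarginal_reads_closingLink (d := d) ρ hρ hL hω hω1 hne hβ p
    apply hUv
    have h := hbl U v
    rw [hMe₁] at h
    exact (div_left_inj' (hMpos U).ne').1 h
  -- Step 1: corner `x + e_k` (`e₁` arrives, `e₂` leaves): blind `e₁` ↔ blind `e₂`
  have hstar1 : ∀ e : Edge d L, e.1 = x.shift k ∨ e.1.shift e.2 = x.shift k → e ≠ e₁ → e ≠ e₂ → e ∈ s := by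
    intro e he hn1 hn2
    rw [hmem_s]
    refine ⟨hn1, hn2, fun h => ?_, fun h => ?_⟩ <;> subst h
    · exact hinc _ _ (show x.shift l ≠ x.shift k from hkl'.symm)
        (show (x.shift l).shift k ≠ x.shift k by rw [← hcomm]; exact hel (x.shift k)) he
    · exact hinc _ _ (show x ≠ x.shift k from (hek x).symm) (show x.shift l ≠ x.shift k from hkl'.symm) he
  have hC1 := arConditional_blind_iff_of_cornerThrough (G := G) (s := s) hFgi e₁ (y := x.shift k)
    (ℓ₁ := e₁) (ℓ₂ := e₂) (fun h => (hek x).symm (congrArg Prod.fst h)) rfl (hek x).symm rfl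
    (hel (x.shift k)) hstar1
  -- Step 2: corner `x + e_k + e_l` (`e₂` and `e₃` both arrive): blind `e₂` ↔ blind `e₃`
  have hstar2 : ∀ e : Edge d L, e.1 = (x.shift k).shift l ∨ e.1.shift e.2 = (x.shift k).shift l →
      e ≠ e₂ → e ≠ e₃ → e ∈ s := by
    intro e he hn1 hn2
    rw [hmem_s]
    refine ⟨fun h => ?_, hn1, hn2, fun h => ?_⟩ <;> subst h
    · exact hinc _ _ (show x ≠ (x.shift k).shift l from hekl.symm)
        (show x.shift k ≠ (x.shift k).shift l from (hel (x.shift k)).symm) he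
    · exact hinc _ _ (show x ≠ (x.shift k).shift l from hekl.symm)
        (show x.shift l ≠ (x.shift k).shift l by rw [hcomm]; exact (hek (x.shift l)).symm) he
  have hC2 := arConditional_blind_iff_of_cornerIn (G := G) (s := s) hFgi e₁ (y := (x.shift k).shift l)
    (ℓ₁ := e₂) (ℓ₂ := e₃) (fun h => hkl' (congrArg Prod.fst h)) rfl (hel (x.shift k)).symm hcomm.symm
    (show x.shift l ≠ (x.shift k).shift l by rw [hcomm]; exact (hek (x.shift l)).symm) hstar2
  -- Step 3: corner `x + e_l` (`e₄` arrives, `e₃` leaves): blind `e₄` ↔ blind `e₃`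
  have hstar3 : ∀ e : Edge d L, e.1 = x.shift l ∨ e.1.shift e.2 = x.shift l → e ≠ e₄ → e ≠ e₃ → e ∈ s := by
    intro e he hn1 hn2
    rw [hmem_s]
    refine ⟨fun h => ?_, fun h => ?_, hn2, hn1⟩ <;> subst h
    · exact hinc _ _ (show x ≠ x.shift l from (hel x).symm) (show x.shift k ≠ x.shift l from hkl') he
    · exact hinc _ _ (show x.shift k ≠ x.shift l from hkl')
        (show (x.shift k).shift l ≠ x.shift l by rw [hcomm]; exact hek (x.shift l)) he
  have hC3 := arConditional_blind_iff_of_cornerThrough (G := G) (s := s) hFgi e₁ (y := x.shift l)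
    (ℓ₁ := e₄) (ℓ₂ := e₃) (fun h => (hel x).symm (congrArg Prod.fst h)) rfl (hel x).symm rfl
    (hek (x.shift l)) hstar3
  -- Step 4: none of the three staple links is blind
  have hn2 : ¬ _ := fun h => hR1 (hC1.2 h)
  have hn3 : ¬ _ := fun h => hn2 (hC2.2 h)
  have hn4 : ¬ _ := fun h => hn3 (hC3.1 h)
  -- Step 5: not blind ⇒ two configurations differing only at `b`
  have key : ∀ b' : Edge d L, (¬ ∀ (U : GaugeConfig d L G) (v : G),
      Nf (update U b' v) / M (update U b' v) = Nf U / M U) →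
      ∃ U U' : GaugeConfig d L G, (∀ e : Edge d L, e ≠ b' → U e = U' e) ∧ Nf U / M U ≠ Nf U' / M U' := by
    intro b' hb'
    push Not at hb'
    obtain ⟨U, v, hUv⟩ := hb'
    exact ⟨U, update U b' v, fun e he => (update_of_ne he _ _).symm, fun h => hUv h.symm⟩
  simp only [Finset.mem_insert, Finset.mem_singleton] at hb
  rcases hb with rfl | rfl | rfl
  · exact key _ hn2
  · exact key _ hn3
  · exact key _ hn4

/-! ## §2 Quantitative symmetry: each staple link carries exactly the influence of the link itself -/

omit [SecondCountableTopology G] in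
/-- **EACH STAPLE LINK CARRIES EXACTLY THE INFLUENCE OF THE CLOSING LINK ITSELF.**  With `R = N/M` the exact
conditional of `U_{e₁}` given the staple, for EVERY configuration `U` and each staple link `b ∈ {e₂, e₃, e₄}`:
`∫ |R(U[b ↦ v]) − R(U)| dv = ∫ |R(U[e₁ ↦ v]) − R(U)| dv` (Haar probability on `G`) — the `L¹(Haar)`
influence of resampling a staple link equals that of resampling the closing link (corner moves + translation
/ inversion invariance of Haar).  Compact `G`, gauge-invariant weight: here the Wilson weight, any `ρ`, `β`,
`d`, `L ≥ 2`. [ours] -/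
theorem wilson_stapleLink_influence_eq (hL : 2 ≤ L) (β : ℝ) (p : Plaquette d L) (U : GaugeConfig d L G) :
    let s : Finset (Edge d L) :=
      Finset.univ \ {(p.1, p.2.1.1), (p.1.shift p.2.1.1, p.2.1.2), (p.1.shift p.2.1.2, p.2.1.1), (p.1, p.2.1.2)}
    let R : GaugeConfig d L G → ℝ := fun V =>
      coordAvg (haarProbability G) s (fun W : GaugeConfig d L G => Real.exp (-β * wilsonAction ρ W)) V /
        coordAvg (haarProbability G) (insert (p.1, p.2.1.1) s)
          (fun W : GaugeConfig d L G => Real.exp (-β * wilsonAction ρ W)) V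
    (∫ v, |R (update U (p.1.shift p.2.1.1, p.2.1.2) v) - R U| ∂(haarProbability G) =
        ∫ v, |R (update U (p.1, p.2.1.1) v) - R U| ∂(haarProbability G)) ∧
      (∫ v, |R (update U (p.1.shift p.2.1.2, p.2.1.1) v) - R U| ∂(haarProbability G) =
        ∫ v, |R (update U (p.1, p.2.1.1) v) - R U| ∂(haarProbability G)) ∧
      (∫ v, |R (update U (p.1, p.2.1.2) v) - R U| ∂(haarProbability G) =
        ∫ v, |R (update U (p.1, p.2.1.1) v) - R U| ∂(haarProbability G)) := by
  intro s R
  classical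
  set μ := haarProbability G with hμ
  set x := p.1 with hx
  set k := p.2.1.1 with hk
  set l := p.2.1.2 with hl
  have hkl : k ≠ l := ne_of_lt p.2.2
  set e₁ : Edge d L := (x, k) with he₁
  set e₂ : Edge d L := (x.shift k, l) with he₂
  set e₃ : Edge d L := (x.shift l, k) with he₃
  set e₄ : Edge d L := (x, l) with he₄
  set F : GaugeConfig d L G → ℝ := fun V => Real.exp (-β * wilsonAction ρ V) with hF
  have hFgi : IsGaugeInvariant F := isGaugeInvariant_wilsonWeightFun ρ β
  -- geometry (`L ≥ 2`, `k ≠ l`)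
  have hek : ∀ z : Site d L, z.shift k ≠ z := fun z => add_single_ne_self hL z k
  have hel : ∀ z : Site d L, z.shift l ≠ z := fun z => add_single_ne_self hL z l
  have hkl' : x.shift k ≠ x.shift l := fun h => hkl (single_inj hL (add_left_cancel h))
  have hcomm : (x.shift k).shift l = (x.shift l).shift k := by
    simp only [Site.shift]; exact add_right_comm _ _ _
  have hekl : (x.shift k).shift l ≠ x := by
    intro h
    apply single_add_single_ne_zero_of_ne hL hkl
    have h' : x + (Pi.single k 1 + Pi.single l 1) = x + 0 := by
      rw [add_zero, ← add_assoc]; exact h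
    exact add_left_cancel h'
  have n12 : e₁ ≠ e₂ := fun h => (hek x).symm (congrArg Prod.fst h)
  have n14 : e₁ ≠ e₄ := fun h => hkl (congrArg Prod.snd h)
  have n23 : e₂ ≠ e₃ := fun h => hkl' (congrArg Prod.fst h)
  have hmem_s : ∀ e : Edge d L, e ∈ s ↔ e ≠ e₁ ∧ e ≠ e₂ ∧ e ≠ e₃ ∧ e ≠ e₄ := by
    intro e
    simp only [s, Finset.mem_sdiff, Finset.mem_univ, true_and, Finset.mem_insert, Finset.mem_singleton,
      not_or]
    exact Iff.rfl
  have hinc : ∀ (e : Edge d L) (y : Site d L), e.1 ≠ y → e.1.shift e.2 ≠ y →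
      ¬ (e.1 = y ∨ e.1.shift e.2 = y) := fun e y h1 h2 h => h.elim h1 h2
  -- the three corner hypotheses
  have hstar1 : ∀ e : Edge d L, e.1 = x.shift k ∨ e.1.shift e.2 = x.shift k → e ≠ e₁ → e ≠ e₂ → e ∈ s := by
    intro e he hn1 hn2
    rw [hmem_s]
    refine ⟨hn1, hn2, fun h => ?_, fun h => ?_⟩ <;> subst h
    · exact hinc _ _ (show x.shift l ≠ x.shift k from hkl'.symm)
        (show (x.shift l).shift k ≠ x.shift k by rw [← hcomm]; exact hel (x.shift k)) he
    · exact hinc _ _ (show x ≠ x.shift k from (hek x).symm) (show x.shift l ≠ x.shift k from hkl'.symm) he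
  have hstar2 : ∀ e : Edge d L, e.1 = (x.shift k).shift l ∨ e.1.shift e.2 = (x.shift k).shift l →
      e ≠ e₂ → e ≠ e₃ → e ∈ s := by
    intro e he hn1 hn2
    rw [hmem_s]
    refine ⟨fun h => ?_, hn1, hn2, fun h => ?_⟩ <;> subst h
    · exact hinc _ _ (show x ≠ (x.shift k).shift l from hekl.symm)
        (show x.shift k ≠ (x.shift k).shift l from (hel (x.shift k)).symm) he
    · exact hinc _ _ (show x ≠ (x.shift k).shift l from hekl.symm)
        (show x.shift l ≠ (x.shift k).shift l by rw [hcomm]; exact (hek (x.shift l)).symm) he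
  have hstar0 : ∀ e : Edge d L, e.1 = x ∨ e.1.shift e.2 = x → e ≠ e₁ → e ≠ e₄ → e ∈ s := by
    intro e he hn1 hn2
    rw [hmem_s]
    refine ⟨hn1, fun h => ?_, fun h => ?_, hn2⟩ <;> subst h
    · exact hinc _ _ (show x.shift k ≠ x from hek x) (show (x.shift k).shift l ≠ x from hekl) he
    · exact hinc _ _ (show x.shift l ≠ x from hel x)
        (show (x.shift l).shift k ≠ x by rw [← hcomm]; exact hekl) he
  -- the three corner moves for `R`
  have hT : ∀ (V : GaugeConfig d L G) (g : G),
      R (update (update V e₁ (V e₁ * g⁻¹)) e₂ (g * V e₂)) = R V := by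
    intro V g
    simp only [R]
    rw [coordAvg_pathHolonomy (s := s) hFgi (y := x.shift k) (ℓ₁ := e₁) (ℓ₂ := e₂) n12 rfl (hek x).symm rfl
        (hel (x.shift k)) hstar1 V g,
      coordAvg_pathHolonomy (s := insert e₁ s) hFgi (y := x.shift k) (ℓ₁ := e₁) (ℓ₂ := e₂) n12 rfl
        (hek x).symm rfl (hel (x.shift k)) (cornerStar_insert e₁ hstar1) V g]
  have hI : ∀ (V : GaugeConfig d L G) (g : G),
      R (update (update V e₂ (V e₂ * g⁻¹)) e₃ (V e₃ * g⁻¹)) = R V := by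
    intro V g
    simp only [R]
    rw [coordAvg_cornerIn (s := s) hFgi (y := (x.shift k).shift l) (ℓ₁ := e₂) (ℓ₂ := e₃) n23 rfl
        (hel (x.shift k)).symm hcomm.symm (by rw [hcomm]; exact (hek (x.shift l)).symm) hstar2 V g,
      coordAvg_cornerIn (s := insert e₁ s) hFgi (y := (x.shift k).shift l) (ℓ₁ := e₂) (ℓ₂ := e₃) n23 rfl
        (hel (x.shift k)).symm hcomm.symm (by rw [hcomm]; exact (hek (x.shift l)).symm)
        (cornerStar_insert e₁ hstar2) V g]
  have hO : ∀ (V : GaugeConfig d L G) (g : G),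
      R (update (update V e₁ (g * V e₁)) e₄ (g * V e₄)) = R V := by
    intro V g
    simp only [R]
    rw [coordAvg_cornerOut (s := s) hFgi (y := x) (ℓ₁ := e₁) (ℓ₂ := e₄) n14 rfl (hek x) rfl (hel x)
        hstar0 V g,
      coordAvg_cornerOut (s := insert e₁ s) hFgi (y := x) (ℓ₁ := e₁) (ℓ₂ := e₄) n14 rfl (hek x) rfl
        (hel x) (cornerStar_insert e₁ hstar0) V g]
  -- resampling `e₂` by `g·` is resampling `e₁` by `·g`
  have h2 : ∀ g : G, R (update U e₂ (g * U e₂)) = R (update U e₁ (U e₁ * g)) := by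
    intro g
    have h := hT (update U e₂ (g * U e₂)) g⁻¹
    rw [inv_inv, update_of_ne n12, update_self, inv_mul_cancel_left, update_comm n12,
      update_idem, update_comm n12.symm,
      Function.update_eq_self_iff.2 (update_of_ne n12.symm (U e₁ * g) U).symm] at h
    exact h.symm
  -- resampling `e₄` by `g·` is resampling `e₁` by `g⁻¹·`
  have h4 : ∀ g : G, R (update U e₄ (g * U e₄)) = R (update U e₁ (g⁻¹ * U e₁)) := by
    intro g
    have h := hO (update U e₄ (g * U e₄)) g⁻¹
    rw [update_of_ne n14, update_self, inv_mul_cancel_left, update_comm n14, update_idem,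
      update_comm n14.symm,
      Function.update_eq_self_iff.2 (update_of_ne n14.symm (g⁻¹ * U e₁) U).symm] at h
    exact h.symm
  -- resampling `e₃` by `·g` is resampling `e₂` by `·g⁻¹`
  have h3 : ∀ g : G, R (update U e₃ (U e₃ * g)) = R (update U e₂ (U e₂ * g⁻¹)) := by
    intro g
    have h := hI (update U e₃ (U e₃ * g)) g
    rw [update_of_ne n23, update_self, mul_inv_cancel_right, update_comm n23, update_idem,
      update_comm n23.symm,
      Function.update_eq_self_iff.2 (update_of_ne n23.symm (U e₂ * g⁻¹) U).symm] at h
    exact h.symm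
  -- the influence of `e₁`, in two translation-invariant forms
  have hR1 : ∫ g, |R (update U e₁ (U e₁ * g)) - R U| ∂μ = ∫ v, |R (update U e₁ v) - R U| ∂μ :=
    integral_mul_left_eq_self (fun v => |R (update U e₁ v) - R U|) (U e₁)
  have hL1 : ∫ g, |R (update U e₁ (g * U e₁)) - R U| ∂μ = ∫ v, |R (update U e₁ v) - R U| ∂μ :=
    integral_mul_right_eq_self (fun v => |R (update U e₁ v) - R U|) (U e₁)
  refine ⟨?_, ?_, ?_⟩
  · -- `e₂`
    calc ∫ v, |R (update U e₂ v) - R U| ∂μ = ∫ g, |R (update U e₂ (g * U e₂)) - R U| ∂μ :=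
          (integral_mul_right_eq_self (fun v => |R (update U e₂ v) - R U|) (U e₂)).symm
      _ = ∫ g, |R (update U e₁ (U e₁ * g)) - R U| ∂μ := by simp_rw [h2]
      _ = _ := hR1
  · -- `e₃`
    have hR2 : ∫ g, |R (update U e₂ (U e₂ * g)) - R U| ∂μ = ∫ v, |R (update U e₂ v) - R U| ∂μ :=
      integral_mul_left_eq_self (fun v => |R (update U e₂ v) - R U|) (U e₂)
    have hL2 : ∫ g, |R (update U e₂ (g * U e₂)) - R U| ∂μ = ∫ v, |R (update U e₂ v) - R U| ∂μ :=
      integral_mul_right_eq_self (fun v => |R (update U e₂ v) - R U|) (U e₂)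
    calc ∫ v, |R (update U e₃ v) - R U| ∂μ = ∫ g, |R (update U e₃ (U e₃ * g)) - R U| ∂μ :=
          (integral_mul_left_eq_self (fun v => |R (update U e₃ v) - R U|) (U e₃)).symm
      _ = ∫ g, |R (update U e₂ (U e₂ * g⁻¹)) - R U| ∂μ := by simp_rw [h3]
      _ = ∫ g, |R (update U e₂ (U e₂ * g)) - R U| ∂μ :=
          integral_inv_eq_self (fun g => |R (update U e₂ (U e₂ * g)) - R U|) μ
      _ = ∫ v, |R (update U e₂ v) - R U| ∂μ := hR2
      _ = ∫ g, |R (update U e₂ (g * U e₂)) - R U| ∂μ := hL2.symm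
      _ = ∫ g, |R (update U e₁ (U e₁ * g)) - R U| ∂μ := by simp_rw [h2]
      _ = _ := hR1
  · -- `e₄`
    calc ∫ v, |R (update U e₄ v) - R U| ∂μ = ∫ g, |R (update U e₄ (g * U e₄)) - R U| ∂μ :=
          (integral_mul_right_eq_self (fun v => |R (update U e₄ v) - R U|) (U e₄)).symm
      _ = ∫ g, |R (update U e₁ (g⁻¹ * U e₁)) - R U| ∂μ := by simp_rw [h4]
      _ = ∫ g, |R (update U e₁ (g * U e₁)) - R U| ∂μ :=
          integral_inv_eq_self (fun g => |R (update U e₁ (g * U e₁)) - R U|) μ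
      _ = _ := hL1

/-- **The `U(1)` instance**: in every dimension, `L ≥ 2`, `β > 0`, the closing link of a plaquette
reads each of its three staple links. [ours] -/
theorem wilson_u1_closingLink_reads_each_stapleLink {d L : ℕ} [NeZero L] (hL : 2 ≤ L) {β : ℝ}
    (hβ : 0 < β) (p : Plaquette d L) (b : Edge d L)
    (hb : b ∈ ({(p.1.shift p.2.1.1, p.2.1.2), (p.1.shift p.2.1.2, p.2.1.1), (p.1, p.2.1.2)} : Finset (Edge d L))) :
    ∃ U U' : GaugeConfig d L Circle,
      (∀ e : Edge d L, e ≠ b → U e = U' e) ∧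
      coordAvg (haarProbability Circle)
          (Finset.univ \ {(p.1, p.2.1.1), (p.1.shift p.2.1.1, p.2.1.2), (p.1.shift p.2.1.2, p.2.1.1), (p.1, p.2.1.2)})
          (fun V : GaugeConfig d L Circle => Real.exp (-β * wilsonAction u1Rep V)) U /
        coordAvg (haarProbability Circle)
          (insert (p.1, p.2.1.1)
            (Finset.univ \ {(p.1, p.2.1.1), (p.1.shift p.2.1.1, p.2.1.2), (p.1.shift p.2.1.2, p.2.1.1), (p.1, p.2.1.2)}))
          (fun V : GaugeConfig d L Circle => Real.exp (-β * wilsonAction u1Rep V)) U ≠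
      coordAvg (haarProbability Circle)
          (Finset.univ \ {(p.1, p.2.1.1), (p.1.shift p.2.1.1, p.2.1.2), (p.1.shift p.2.1.2, p.2.1.1), (p.1, p.2.1.2)})
          (fun V : GaugeConfig d L Circle => Real.exp (-β * wilsonAction u1Rep V)) U' /
        coordAvg (haarProbability Circle)
          (insert (p.1, p.2.1.1)
            (Finset.univ \ {(p.1, p.2.1.1), (p.1.shift p.2.1.1, p.2.1.2), (p.1.shift p.2.1.2, p.2.1.1), (p.1, p.2.1.2)}))
          (fun V : GaugeConfig d L Circle => Real.exp (-β * wilsonAction u1Rep V)) U' :=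
  wilson_closingLink_reads_each_stapleLink u1Rep continuous_u1Rep hL u1Rep_neg_one (by simp) (by norm_num)
    hβ p b hb

end Summit.Ventures.LatticeQCDFlow.Theory2.Autoregressive

end
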